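import Literature.Computability.MetaComplexity.EFModMulULD
import HarnessLib

/-!
# Small carry systems and rules for the unit, shift and commutativity laws of modular multiplication

Layer E/5 (uniform variant), preparations. Sound schematic rules and carry systems
(`EFCluster.lean`) used by the laws `0 ⊗ b = 0`, `1 ⊗ b = b`, the shift law and commutativity:

* rules: doubling (`s ↔ xor3(x,x,κ)` gives `s ↔ κ`; `κ' ↔ maj(x,x,κ)` gives `κ' ↔ x`), masks with
  a false operand, disjointness of conjunctions, reading a disjunction with a false disjunct,
  copy gates and the first-position flag, trivial implications;
* `DOR` — addition of words of disjoint support is disjunction (no carries);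
* `MONO` — a word bitwise below a word `< n` is `< n`;
* `SHIFTR` — `b < n` gives `b >> 1 < n` (the next bit of `b` enters as an input tied to `b` at
  the next position through a copy gate);
* `ZADDR` — `x ⊕ 0 = x` for `x < n`.

## Sources

* S. A. Cook, R. A. Reckhow, *The relative efficiency of propositional proof systems*,
  J. Symbolic Logic 44 (1979), §2.
-/

namespace Literature.Computability.MetaComplexity

open _root_.Computability Complexity Complexity.PropForm Netlist Cluster FregeSystem

namespace ModMulU

namespace Sys

/-! ### Rules -/

/-- Doubling, sum bit: `s ↔ xor3(x, x, κ)` gives `s ↔ κ`. [cite: CookReckhow1979, §2 (sound rule)] -/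
def rDblS : FregeRule := ⟨[ctx (var 0) (biimp (var 1) (xor3F (var 2) (var 2) (var 3)))], ctx (var 0) (biimp (var 1) (var 3))⟩
/-- Doubling, carry: `κ' ↔ maj(x, x, κ)` gives `κ' ↔ x`. [cite: CookReckhow1979, §2 (sound rule)] -/
def rDblC : FregeRule := ⟨[ctx (var 0) (biimp (var 1) (majF (var 2) (var 2) (var 3)))], ctx (var 0) (biimp (var 1) (var 2))⟩
/-- A mask with a false operand: `m ↔ g ∧ x`, `¬x` give `¬m`. [cite: CookReckhow1979, §2 (sound rule)] -/
def rAndF2 : FregeRule := ⟨[ctx (var 0) (biimp (var 1) (conj (var 2) (var 3))), ctx (var 0) (neg (var 3))], ctx (var 0) (neg (var 1))⟩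
/-- `¬u` gives `¬(u ∧ v)`. [cite: CookReckhow1979, §2 (sound rule)] -/
def rNAndL : FregeRule := ⟨[ctx (var 0) (neg (var 1))], ctx (var 0) (neg (conj (var 1) (var 2)))⟩
/-- `¬v` gives `¬(u ∧ v)`. [cite: CookReckhow1979, §2 (sound rule)] -/
def rNAndR : FregeRule := ⟨[ctx (var 0) (neg (var 2))], ctx (var 0) (neg (conj (var 1) (var 2)))⟩
/-- `s ↔ u ∨ v`, `¬v` give `s ↔ u`. [cite: CookReckhow1979, §2 (sound rule)] -/
def rOrFR : FregeRule := ⟨[ctx (var 0) (biimp (var 1) (disj (var 2) (var 3))), ctx (var 0) (neg (var 3))], ctx (var 0) (biimp (var 1) (var 2))⟩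
/-- `s ↔ u ∨ v`, `¬u` give `s ↔ v`. [cite: CookReckhow1979, §2 (sound rule)] -/
def rOrFL : FregeRule := ⟨[ctx (var 0) (biimp (var 1) (disj (var 2) (var 3))), ctx (var 0) (neg (var 2))], ctx (var 0) (biimp (var 1) (var 3))⟩
/-- Reading a copy gate: `p ↔ u ∧ u` gives `u ↔ p`. [cite: CookReckhow1979, §2 (sound rule)] -/
def rCopy : FregeRule := ⟨[ctx (var 0) (biimp (var 1) (conj (var 2) (var 2)))], ctx (var 0) (biimp (var 2) (var 1))⟩
/-- A copy of a false constant: `p ↔ u ∧ u`, `u ↔ ⊥` give `¬p`. [cite: CookReckhow1979, §2 (sound rule)] -/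
def rCopyCstF : FregeRule :=
  ⟨[ctx (var 0) (biimp (var 1) (conj (var 2) (var 2))), ctx (var 0) (biimp (var 2) (const false))], ctx (var 0) (neg (var 1))⟩
/-- The first-position flag: `f ↔ ⊤` gives `f ∨ w`. [cite: CookReckhow1979, §2 (sound rule)] -/
def rFlagT : FregeRule := ⟨[ctx (var 0) (biimp (var 1) (const true))], ctx (var 0) (disj (var 1) (var 2))⟩
/-- `w` gives `f ∨ w`. [cite: CookReckhow1979, §2 (sound rule)] -/
def rOrIntroR : FregeRule := ⟨[ctx (var 0) (var 2)], ctx (var 0) (disj (var 1) (var 2))⟩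
/-- `u ↔ ⊥` gives `¬u ∨ w`. [cite: CookReckhow1979, §2 (sound rule)] -/
def rImpOfCstF : FregeRule := ⟨[ctx (var 0) (biimp (var 1) (const false))], ctx (var 0) (disj (neg (var 1)) (var 2))⟩
/-- `¬u ∨ u`. [cite: CookReckhow1979, §2 (sound rule)] -/
def rImpRefl : FregeRule := ⟨[], ctx (var 0) (disj (neg (var 1)) (var 1))⟩
/-- `¬u` gives `¬u ∨ w`... as the disjointness premise: `¬v` gives `¬(u ∧ v)` is `rNAndR`; here
`u ↔ ⊥` gives `¬(u ∧ v)`. [cite: CookReckhow1979, §2 (sound rule)] -/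
def rNAndCstL : FregeRule := ⟨[ctx (var 0) (biimp (var 1) (const false))], ctx (var 0) (neg (conj (var 1) (var 2)))⟩
/-- `v ↔ ⊥` gives `¬(u ∧ v)`. [cite: CookReckhow1979, §2 (sound rule)] -/
def rNAndCstR : FregeRule := ⟨[ctx (var 0) (biimp (var 2) (const false))], ctx (var 0) (neg (conj (var 1) (var 2)))⟩

/-- The glue rules of this layer. [cite: CookReckhow1979, §2] -/
def glue : List FregeRule :=
  [rDblS, rDblC, rAndF2, rNAndL, rNAndR, rOrFR, rOrFL, rCopy, rCopyCstF, rFlagT, rOrIntroR, rImpOfCstF, rImpRefl, rNAndCstL,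
    rNAndCstR]

/-- Every glue rule is sound (truth tables). [cite: CookReckhow1979, §2 (sound rule)] -/
theorem isSound_of_mem_glue : ∀ r ∈ glue, r.IsSound := by
  intro r hr
  simp only [glue, List.mem_cons, List.not_mem_nil, or_false] at hr
  rcases hr with rfl | rfl | rfl | rfl | rfl | rfl | rfl | rfl | rfl | rfl | rfl | rfl | rfl | rfl | rfl <;>
    exact FregeRule.isSound_of_check (by decide +kernel)

/-- Inference by glue rule number `i`. [folklore] -/
theorem glue_infer {G : FregeSystem} (hG : ∀ r ∈ glue, r ∈ G.rules) (i : ℕ) (hi : i < glue.length) {S : Set (PropForm ℕ)}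
    (σ : ℕ → PropForm ℕ) {φ : PropForm ℕ} (hφ : (glue[i]).conclusion.subst σ = φ)
    (hp : ∀ ψ ∈ (glue[i]).premises, ψ.subst σ ∈ S) : G.IsInferredFrom S φ :=
  hφ ▸ FregeSystem.IsInferredFrom.of_rule (hG _ (List.getElem_mem hi)) σ rfl hp

/-! ### Systems -/

/-- **System `DOR`**: the ripple adder on words of disjoint support (premise shape `¬(x ∧ y)`): no carries, every sum bit is `x ∨ y` (per-position rule).
Leaves: 1 ka, 2 x, 3 y; defined: 4 s, 5 ka2. Invariant: the reachable carry states (1 terms). [folklore] -/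
def DOR : System where
  cins := [biimp (var 1) (const false)]
  shapes := [biimp (var 4) (xor3F (var 2) (var 3) (var 1)),
    biimp (var 5) (majF (var 2) (var 3) (var 1)),
    neg (conj (var 2) (var 3))]
  inv := (neg (var 1))
  next := fun k => if k = 1 then 5 else k

/-- Per-position rule of `DOR`: `s ↔ x ∨ y`. [cite: CookReckhow1979, §2 (sound rule)] -/
def rDORPos : FregeRule := DOR.endRule DOR.shapes (biimp (var 4) (disj (var 2) (var 3)))

/-- **System `MONO`**: two comparators `(a, n)` and `(x, n)` with `x ≤ a` bitwise (premise shape `x → a`): `a < n` gives `x < n` (end rule).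
Leaves: 1 gA, 2 gX, 3 a, 4 x, 5 n; defined: 6 nA, 7 gA2, 8 nX, 9 gX2. Invariant: the reachable carry states (2 terms). [folklore] -/
def MONO : System where
  cins := [biimp (var 1) (const true), biimp (var 2) (const true)]
  shapes := [biimp (var 6) (neg (var 5)),
    biimp (var 7) (majF (var 3) (var 6) (var 1)),
    biimp (var 8) (neg (var 5)),
    biimp (var 9) (majF (var 4) (var 8) (var 2)),
    disj (neg (var 4)) (var 3)]
  inv := (disj (neg (var 2)) (var 1))
  next := fun k => if k = 1 then 7 else if k = 2 then 9 else k

/-- End rule of `MONO`: `¬ge(a,n)` gives `¬ge(x,n)`. [cite: CookReckhow1979, §2 (sound rule)] -/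
def rMONOEnd : FregeRule := MONO.endRule [neg (var 1)] (neg (var 2))

/-- **System `SHIFTR`**: the comparators `(b, n)` and `(b >> 1, n)`; the input `b1` is the next bit of `b` (the zero gate at the top), tied to `b` at the next position through the copy state `px` (premise shape `f ∨ (b ↔ px)` with the first-position flag `f`): `b < n` and `¬px` at the end give `b >> 1 < n` (end rule).
Leaves: 1 gB, 2 gH, 3 px, 4 f, 5 b, 6 b1, 7 n; defined: 8 nB, 9 gB2, 10 nH, 11 gH2, 12 px2, 13 f2. Invariant: the reachable carry states (5 terms). [folklore] -/
def SHIFTR : System where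
  cins := [biimp (var 1) (const true), biimp (var 2) (const true), biimp (var 3) (const false), biimp (var 4) (const true)]
  shapes := [biimp (var 8) (neg (var 7)),
    biimp (var 9) (majF (var 5) (var 8) (var 1)),
    biimp (var 10) (neg (var 7)),
    biimp (var 11) (majF (var 6) (var 10) (var 2)),
    biimp (var 12) (conj (var 6) (var 6)),
    biimp (var 13) (const false),
    disj (var 4) (biimp (var 5) (var 3))]
  inv := (disj (disj (conj (neg (var 1)) (conj (var 3) (neg (var 4)))) (conj (neg (var 2)) (conj (neg (var 3)) (neg (var 4))))) (disj (conj (var 1) (conj (neg (var 3)) (neg (var 4)))) (disj (conj (var 1) (conj (var 2) (neg (var 3)))) (conj (var 1) (conj (var 2) (neg (var 4)))))))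
  next := fun k => if k = 1 then 9 else if k = 2 then 11 else if k = 3 then 12 else if k = 4 then 13 else k

/-- End rule of `SHIFTR`: `¬ge(b,n)`, `¬px` give `¬ge(b >> 1, n)`. [cite: CookReckhow1979, §2 (sound rule)] -/
def rSHIFTREnd : FregeRule := SHIFTR.endRule [neg (var 1), neg (var 3)] (neg (var 2))

/-- **System `ZADDR`**: the modular adder `x ⊕ 0` (premise shape `¬y`) with the comparator `(x, n)`: every sum bit equals `x` (per-position rule) and `x < n` gives `¬ge` (end rule).
Leaves: 1 ka, 2 gD, 3 gA, 4 x, 5 y, 6 n; defined: 7 s, 8 ka2, 9 nD, 10 gD2, 11 nA, 12 gA2. Invariant: the reachable carry states (2 terms). [folklore] -/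
def ZADDR : System where
  cins := [biimp (var 1) (const false), biimp (var 2) (const true), biimp (var 3) (const true)]
  shapes := [biimp (var 7) (xor3F (var 4) (var 5) (var 1)),
    biimp (var 8) (majF (var 4) (var 5) (var 1)),
    biimp (var 9) (neg (var 6)),
    biimp (var 10) (majF (var 7) (var 9) (var 2)),
    biimp (var 11) (neg (var 6)),
    biimp (var 12) (majF (var 4) (var 11) (var 3)),
    neg (var 5)]
  inv := (disj (conj (neg (var 1)) (conj (neg (var 2)) (neg (var 3)))) (conj (neg (var 1)) (conj (var 2) (var 3))))
  next := fun k => if k = 1 then 8 else if k = 2 then 10 else if k = 3 then 12 else k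

/-- Per-position rule of `ZADDR`: `s ↔ x`. [cite: CookReckhow1979, §2 (sound rule)] -/
def rZADDRPos : FregeRule := ZADDR.endRule ZADDR.shapes (biimp (var 7) (var 4))

/-- End rule of `ZADDR`. [cite: CookReckhow1979, §2 (sound rule)] -/
def rZADDREnd : FregeRule := ZADDR.endRule [neg (var 3)] (neg (var 2))

/-- The system rules of this layer. [cite: CookReckhow1979, §2] -/
def sysRules : List FregeRule :=
  [DOR.baseRule, DOR.stepRule, rDORPos, MONO.baseRule, MONO.stepRule, rMONOEnd, SHIFTR.baseRule, SHIFTR.stepRule, rSHIFTREnd,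
    ZADDR.baseRule, ZADDR.stepRule, rZADDRPos, rZADDREnd]

/-- Every system rule is sound. [cite: CookReckhow1979, §2 (sound rule)] -/
theorem isSound_of_mem_sysRules : ∀ r ∈ sysRules, r.IsSound := by
  intro r hr
  simp only [sysRules, List.mem_cons, List.not_mem_nil, or_false] at hr
  rcases hr with rfl | rfl | rfl | rfl | rfl | rfl | rfl | rfl | rfl | rfl | rfl | rfl | rfl
  · exact FregeRule.isSound_of_check (by decide +kernel)
  · exact FregeRule.isSound_of_checkD (V := 4) (ds := DOR.ds) (by decide +kernel)
  · exact FregeRule.isSound_of_checkD (V := 4) (ds := DOR.ds) (by decide +kernel)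
  · exact FregeRule.isSound_of_check (by decide +kernel)
  · exact FregeRule.isSound_of_checkD (V := 6) (ds := MONO.ds) (by decide +kernel)
  · exact FregeRule.isSound_of_check (by decide +kernel)
  · exact FregeRule.isSound_of_check (by decide +kernel)
  · exact FregeRule.isSound_of_checkD (V := 8) (ds := SHIFTR.ds) (by decide +kernel)
  · exact FregeRule.isSound_of_check (by decide +kernel)
  · exact FregeRule.isSound_of_check (by decide +kernel)
  · exact FregeRule.isSound_of_checkD (V := 7) (ds := ZADDR.ds) (by decide +kernel)
  · exact FregeRule.isSound_of_checkD (V := 7) (ds := ZADDR.ds) (by decide +kernel)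
  · exact FregeRule.isSound_of_check (by decide +kernel)

/-- Leaf side conditions. [folklore] -/
theorem dorLeavesOK : DOR.LeavesOK := System.leavesOK_of_leavesOKB (by decide +kernel)
/-- Leaf side conditions. [folklore] -/
theorem monoLeavesOK : MONO.LeavesOK := System.leavesOK_of_leavesOKB (by decide +kernel)
/-- Leaf side conditions. [folklore] -/
theorem shiftrLeavesOK : SHIFTR.LeavesOK := System.leavesOK_of_leavesOKB (by decide +kernel)
/-- Leaf side conditions. [folklore] -/
theorem zaddrLeavesOK : ZADDR.LeavesOK := System.leavesOK_of_leavesOKB (by decide +kernel)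

/-- Membership in `sysRules` by position. [folklore] -/
theorem mem_sysRules {i : ℕ} (hi : i < sysRules.length) : sysRules[i] ∈ sysRules := List.getElem_mem hi

end Sys

end ModMulU

end Literature.Computability.MetaComplexity
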